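import Summits.ValiantsHypothesis.ValiantsHypothesis.Theses.UlrichPadded
import Literature.Computability.AlgebraicComplexity.PermanentIrreducible
import Literature.Computability.AlgebraicComplexity.VonZurGathenSingPermHeight
import Literature.RingTheory.RegularLocalRing.GrothendieckSamuelHypersurfaceKernel
import Literature.RingTheory.RegularLocalRing.GradedFactorialProofs
import Literature.RingTheory.GradedAlgebra.QuotientGrading
import Literature.AlgebraicGeometry.Resolution.RegularLocalRingsJacobian

/-!
# Crux `PermHypersurfaceFactorial` (stmt-ValiantsHypothesis-5666, route `UlrichPadded`) —
line `derivation-symbolic-square`, lead skeleton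

Crux (the route's decl, concluded BY NAME below):
`UlrichPadded.PermHypersurfaceFactorial :
  ∀ n ≥ 3, ∀ P : Ideal (ℂ[x_ij] ⧸ (per_n)), P.IsPrime → P.height = 1 → P.IsPrincipal`
("`S_n = ℂ[x_{n×n}]/(per_n)` is factorial").

The line (planner skeleton `Cruxes/PermHypersurfaceFactorial/Lines/derivation-symbolic-square.lean`,
card `Lines/derivation-symbolic-square.md`; lead `prover-line-stmt-ValiantsHypothesis-5666-0`):

1. `stub_missingPartial` — von zur Gathen's PROVED height bound
   (`vonzurGathen1987_singPerm_height_holds`: primes of `ℂ[x]` over `(per_n, ∂per_n)` have height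
   `≥ 5`, `n ≥ 3`) + the bookkeeping `ht 𝔮 = ht P + 1`: every prime of `S_n` of height `≤ 3`
   misses some partial `∂per_n/∂x_ij` upstairs.
2. `stub_regular_of_pderiv_notMem` — the derivation test: `f ∈ 𝔮`, `∂f/∂x_i ∉ 𝔮` ⇒ `f ∉ 𝔪_𝔮²`
   in the regular local ring `K[σ]_𝔮` ⇒ `K[σ]_𝔮/(f)` regular ⇒ `(K[σ]/(f))_P` regular.
   (1 + 2: `S_n` is regular in codimension `≤ 3`.)
3. `stub_localFactorial` — Grothendieck–Samuel (SGA 2 XI 3.14, hypersurface case, PROVED in tree: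
   `Grothendieck1968_samuelConjecture_hypersurface_holds` / `.regular_codim_three`) at `ℂ[x]_𝔪`,
   transported along `(S_n)_M ≅ ℂ[x]_𝔪/(per_n)`: every local ring of `S_n` is factorial.
4. `stub_gradedDescent` — Fossum 1973 Cor. 10.3, normality-free tree form
   `uniqueFactorizationMonoid_of_atIrrelevant`, on the total-degree grading of `S_n`:
   factorial at every maximal ideal ⇒ `S_n` factorial.

`PermHypersurfaceFactorial_of` composes 1–4 with Mathlib
`UniqueFactorizationMonoid.isPrincipal_of_height_eq_one`.

Disproof.lean (gen-2 v7) honoured: `permHypersurfaceFactorial_false_without_three_le` — `3 ≤ n` is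
consumed at stub 1 (vzG needs `m ≥ 3`); `permHypersurfaceFactorial_false_without_heightOne` —
`P.height = 1` is consumed in the last line.
-/

noncomputable section

namespace Summit.ValiantsHypothesis.Theorems.PermHypersurfaceFactorial

open MvPolynomial IsLocalRing Literature.Computability.AlgebraicComplexity

/-! ## The registered stubs -/

/-- **Stub 1 (vzG input + height bookkeeping): a prime of `S_n` of height `≤ 3` misses a partial.**
For `n ≥ 3` and a prime `P` of `S_n = ℂ[x]/(per_n)` with `ht P ≤ 3`, some `∂per_n/∂x_ij` is not in
the preimage `𝔮` of `P` in `ℂ[x]`: `ht 𝔮 = ht P + 1 ≤ 4`, while `𝔮 ⊇ singPermIdeal ℂ n` would force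
`ht 𝔮 ≥ 5` (`vonzurGathen1987_singPerm_height_holds`). [folklore] -/
theorem stub_missingPartial :
    ∀ n : ℕ, 3 ≤ n →
      ∀ (P : Ideal (MvPolynomial (Fin n × Fin n) ℂ ⧸ Ideal.span {perPoly (Fin n) ℂ})) [P.IsPrime],
        P.height ≤ 3 →
          ∃ ij : Fin n × Fin n, pderiv ij (perPoly (Fin n) ℂ) ∉
            P.comap (Ideal.Quotient.mk (Ideal.span {perPoly (Fin n) ℂ})) := by
  sorry

/-- **Stub 2 (the lever: derivation test ⇒ regularity).** For a field `K`, finitely many variables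
`σ`, `f ∈ K[σ]`, and a prime `P` of `K[σ]/(f)` whose preimage `𝔮` misses some partial `∂f/∂x_i`,
the local ring `(K[σ]/(f))_P` is regular: a derivation maps `𝔮^(2)` into `𝔮`, so `f ∉ 𝔪_𝔮²` in the
regular local ring `K[σ]_𝔮`, hence `K[σ]_𝔮/(f) ≅ (K[σ]/(f))_P` is regular. [folklore] -/
theorem stub_regular_of_pderiv_notMem :
    ∀ (σ K : Type) [Finite σ] [Field K] (f : MvPolynomial σ K) (i : σ)
      (P : Ideal (MvPolynomial σ K ⧸ Ideal.span {f})) [P.IsPrime],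
      pderiv i f ∉ P.comap (Ideal.Quotient.mk (Ideal.span {f})) →
        IsRegularLocalRing (Localization.AtPrime P) := by
  sorry

/-- **Stub 3 (Grothendieck–Samuel, transported): regular in codimension `≤ 3` ⇒ locally
factorial.** If every localisation of `S_n` at a prime of height `≤ 3` is regular, then every local
ring `(S_n)_M` is factorial — `Grothendieck1968_samuelConjecture_hypersurface.regular_codim_three`
at the regular local ring `ℂ[x]_𝔪`, `𝔪 = M.comap mk`, transported through
`(S_n)_M ≅ ℂ[x]_𝔪/(per_n)` and localisation-of-localisation. [folklore] -/
theorem stub_localFactorial :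
    ∀ n : ℕ, 3 ≤ n →
      (∀ (Q : Ideal (MvPolynomial (Fin n × Fin n) ℂ ⧸ Ideal.span {perPoly (Fin n) ℂ})) [Q.IsPrime],
          Q.height ≤ 3 → IsRegularLocalRing (Localization.AtPrime Q)) →
        ∀ (M : Ideal (MvPolynomial (Fin n × Fin n) ℂ ⧸ Ideal.span {perPoly (Fin n) ℂ})) [M.IsPrime],
          ∃ _ : IsDomain (Localization.AtPrime M),
            UniqueFactorizationMonoid (Localization.AtPrime M) := by
  sorry

/-- **Stub 4 (graded descent, Fossum 1973 Cor. 10.3, normality-free): locally factorial at the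
maximal ideals ⇒ `S_n` factorial** — `uniqueFactorizationMonoid_of_atIrrelevant` on the
total-degree grading of the noetherian domain `S_n` (irrelevant ideal `(x̄_ij)` maximal,
degree-`0` part `ℂ`). [folklore] -/
theorem stub_gradedDescent :
    ∀ n : ℕ, 3 ≤ n →
      (∀ (M : Ideal (MvPolynomial (Fin n × Fin n) ℂ ⧸ Ideal.span {perPoly (Fin n) ℂ})) [M.IsMaximal],
          ∃ _ : IsDomain (Localization.AtPrime M),
            UniqueFactorizationMonoid (Localization.AtPrime M)) →
        ∃ _ : IsDomain (MvPolynomial (Fin n × Fin n) ℂ ⧸ Ideal.span {perPoly (Fin n) ℂ}),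
          UniqueFactorizationMonoid (MvPolynomial (Fin n × Fin n) ℂ ⧸ Ideal.span {perPoly (Fin n) ℂ}) := by
  sorry

/-! ## The kernel-checked composition -/

/-- **The line closes the crux**: stubs 1 + 2 give regularity of `S_n` in codimension `≤ 3`,
stub 3 (Grothendieck–Samuel) makes every local ring factorial, stub 4 (Fossum) globalises, and a
height-one prime of a UFD is principal (`UniqueFactorizationMonoid.isPrincipal_of_height_eq_one`).
[folklore] -/
theorem PermHypersurfaceFactorial_of :
    Summit.ValiantsHypothesis.ValiantsHypothesis.Theses.UlrichPadded.PermHypersurfaceFactorial := by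
  intro n hn P hP hht
  -- stubs 1 + 2: `S_n` is regular in codimension ≤ 3
  have hreg : ∀ (Q : Ideal (MvPolynomial (Fin n × Fin n) ℂ ⧸ Ideal.span {perPoly (Fin n) ℂ}))
      [Q.IsPrime], Q.height ≤ 3 → IsRegularLocalRing (Localization.AtPrime Q) := by
    intro Q _ hQ
    obtain ⟨ij, hij⟩ := stub_missingPartial n hn Q hQ
    exact stub_regular_of_pderiv_notMem (Fin n × Fin n) ℂ (perPoly (Fin n) ℂ) ij Q hij
  -- stub 3: every local ring of `S_n` is factorial (Grothendieck–Samuel, SGA 2 XI 3.14)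
  have hloc := stub_localFactorial n hn hreg
  -- stub 4: `S_n` is factorial (Fossum 1973, Cor. 10.3)
  obtain ⟨hdom, hufm⟩ := stub_gradedDescent n hn (fun M _ => hloc M)
  -- a height-one prime of a UFD is principal
  haveI := hP
  exact UniqueFactorizationMonoid.isPrincipal_of_height_eq_one hht

end Summit.ValiantsHypothesis.Theorems.PermHypersurfaceFactorial

end
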